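import Mathlib
import Summits.Ventures.PercRepro2.ZMean
import Summits.Ventures.PercRepro2.ZMeanBound
import Summits.Ventures.PercRepro2.PocketConn
import Summits.Ventures.PercRepro2.PocketLaw

/-!
# The PD rows of `X̂` in a root-only pocket

Step (i) of the mean-field bookkeeping of the root-only-pocket theorem: for a cluster `K ⊆ P`
of the pocket, the residual event `Q_K = {a₁ ↮ a₂ in G ∖ K}` splits into its pocket part
`QPocketDel` and the outside part `QOutside` (`delQ_eq`), the residual masses of `termPD`
factor by the pocket law (`prob_delQ_inter_connDel`), and the PD-type term of `X̂` on `K`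
is `P(Q_{P∖K}) · (A_L¹B_H¹ + A_H¹B_L¹) / Z₁` with the outside masses `A_L¹ = P(Q₁, a₁ ↔₁ o)`,
… (`termPD_pocket`): the residual graph `G ∖ K` sees the pocket only through `P(Q_{P∖K})`.
-/

namespace Summit.Ventures.PercRepro2

namespace PocketConn

variable {V : Type*} {E : Type*}

/-- `restrict` commutes. -/
lemma restrict_comm (F G : Set E) [DecidablePred (· ∈ F)] [DecidablePred (· ∈ G)]
    (ω : Config E) : restrict F (restrict G ω) = restrict G (restrict F ω) := by
  funext e
  simp only [restrict]
  rw [Bool.and_right_comm]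

/-- Restricting twice restricts to the intersection. -/
lemma restrict_restrict' (F G : Set E) [DecidablePred (· ∈ F)] [DecidablePred (· ∈ G)]
    [DecidablePred (· ∈ F ∩ G)] (ω : Config E) :
    restrict F (restrict G ω) = restrict (F ∩ G) ω := by
  funext e
  by_cases hF : e ∈ F <;> by_cases hG : e ∈ G <;> simp [restrict, hF, hG]

/-- The cluster of a vertex whose cluster lies inside `P` is the same in the pocket
configuration. -/
lemma cluster_restrict_touches_eq {ends : E → Sym2 V} {ω : Config E} {P : Set V}
    [DecidablePred (· ∈ touches ends P)] {v : V} (hv : cluster ends ω v ⊆ P) :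
    cluster ends (restrict (touches ends P) ω) v = cluster ends ω v := by
  apply Set.Subset.antisymm
  · intro z hz
    rw [mem_cluster] at hz ⊢
    exact conn_mono (restrict_le _ ω) hz
  · intro z hz
    rw [mem_cluster] at hz ⊢
    have key : z ∈ {w | Conn ends (restrict (touches ends P) ω) v w} := by
      refine mem_of_conn_of_closed (ends := ends) (ω := ω) ?_ (conn_refl _ _ _) hz
      rintro x hx y hxy
      obtain ⟨_, e, he, hends⟩ := openGraph_adj.1 hxy
      simp only [Set.mem_setOf_eq] at hx ⊢
      have hxP : x ∈ P := hv (by rw [mem_cluster]; exact conn_mono (restrict_le _ ω) hx)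
      exact conn_trans hx (conn_of_openAdj (openAdj_restrict_touches he hends (Or.inl hxP)))
    exact key

section Finite

variable [Fintype V] [DecidableEq V]

/-- The pocket part of the residual event `Q_K`: after closing the edges touching `K`, the roots
are not connected by pocket edges. -/
def QPocketDel (ends : E → Sym2 V) (P : Finset V) (K : Finset V) (a₁ a₂ : V) :
    Set (Config E) :=
  {ω | ¬ Conn ends (restrict (touches ends (↑K : Set V))ᶜ
    (restrict (touches ends (↑P : Set V)) ω)) a₁ a₂}

/-- The outside mass `P(Q₁, x ↔₁ v)`: the roots are not connected outside the pocket and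
`x, v` are connected outside the pocket. -/
noncomputable def outMass [Fintype E] [DecidableEq E] {R : Type*} [CommRing R] (p : E → R)
    (ends : E → Sym2 V) (P : Finset V) (a₁ a₂ x v : V) : R :=
  prob p (QOutside ends (↑P : Set V) a₁ a₂ ∩
    {ω | Conn ends (restrict (touches ends (↑P : Set V))ᶜ ω) x v})

variable {ends : E → Sym2 V} {P K : Finset V} {a₁ a₂ : V}

/-- The residual `Q_K` (`K ⊆ P`) is the residual pocket part times the outside part. -/
theorem delQ_eq (hP : IsPocket ends (↑P : Set V) a₁ a₂) (hKP : K ⊆ P) (h1 : a₁ ∉ P)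
    (h2 : a₂ ∉ P) :
    delQ ends K a₁ a₂ = QPocketDel ends P K a₁ a₂ ∩ QOutside ends (↑P : Set V) a₁ a₂ := by
  have hKP' : (↑K : Set V) ⊆ (↑P : Set V) := Finset.coe_subset.2 hKP
  ext ω
  simp only [delQ, Set.mem_compl_iff, mem_connDelEvent, QPocketDel, QOutside, Set.mem_inter_iff,
    Set.mem_setOf_eq]
  rw [conn_roots_iff hP (by simpa using h1) (by simpa using h2), not_or,
    restrict_compl_restrict_compl_of_subset hKP', restrict_comm]

/-- Membership in the residual `Q_K` in terms of the two parts. -/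
theorem mem_delQ_iff (hP : IsPocket ends (↑P : Set V) a₁ a₂) (hKP : K ⊆ P) (h1 : a₁ ∉ P)
    (h2 : a₂ ∉ P) {ω : Config E} :
    ¬ Conn ends (restrict (touches ends (↑K : Set V))ᶜ ω) a₁ a₂ ↔
      ω ∈ QPocketDel ends P K a₁ a₂ ∧ ω ∈ QOutside ends (↑P : Set V) a₁ a₂ := by
  have h := delQ_eq hP hKP h1 h2
  have hω : ω ∈ delQ ends K a₁ a₂ ↔ ω ∈ QPocketDel ends P K a₁ a₂ ∩
      QOutside ends (↑P : Set V) a₁ a₂ := by rw [h]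
  simpa only [delQ, Set.mem_compl_iff, mem_connDelEvent, Set.mem_inter_iff] using hω

/-- On `Q_K`, a residual connection between two vertices outside the pocket is an outside
connection: the event `Q_K ∩ {x ↔ v in G ∖ K}` is the residual pocket part times the outside
event `Q₁ ∩ {x ↔₁ v}`. -/
theorem delQ_inter_connDel_eq (hP : IsPocket ends (↑P : Set V) a₁ a₂) (hKP : K ⊆ P)
    (h1 : a₁ ∉ P) (h2 : a₂ ∉ P) {x v : V} (hx : x ∉ P) (hv : v ∉ P) :
    delQ ends K a₁ a₂ ∩ connDelEvent ends K x v =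
      QPocketDel ends P K a₁ a₂ ∩ (QOutside ends (↑P : Set V) a₁ a₂ ∩
        {ω | Conn ends (restrict (touches ends (↑P : Set V))ᶜ ω) x v}) := by
  have hKP' : (↑K : Set V) ⊆ (↑P : Set V) := Finset.coe_subset.2 hKP
  ext ω
  simp only [Set.mem_inter_iff, mem_connDelEvent, Set.mem_setOf_eq, delQ, Set.mem_compl_iff]
  rw [mem_delQ_iff hP hKP h1 h2]
  constructor
  · rintro ⟨⟨hQP, hQ1⟩, hc⟩
    have hQ : ¬ Conn ends (restrict (touches ends (↑K : Set V))ᶜ ω) a₁ a₂ :=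
      (mem_delQ_iff hP hKP h1 h2).2 ⟨hQP, hQ1⟩
    exact ⟨hQP, hQ1, (conn_residual_iff hP hKP' hQ (by simpa using hx) (by simpa using hv)).1 hc⟩
  · rintro ⟨hQP, hQ1, hc⟩
    have hQ : ¬ Conn ends (restrict (touches ends (↑K : Set V))ᶜ ω) a₁ a₂ :=
      (mem_delQ_iff hP hKP h1 h2).2 ⟨hQP, hQ1⟩
    exact ⟨⟨hQP, hQ1⟩, (conn_residual_iff hP hKP' hQ (by simpa using hx) (by simpa using hv)).2 hc⟩

section Prob

variable [Fintype E] [DecidableEq E] {R : Type*} [CommRing R]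

/-- The residual mass `P(Q_K, x ↔ v in G ∖ K)` factors as `P(residual pocket Q) · P(Q₁, x ↔₁ v)`. -/
theorem prob_delQ_inter_connDel (p : E → R) (hP : IsPocket ends (↑P : Set V) a₁ a₂)
    (hKP : K ⊆ P) (h1 : a₁ ∉ P) (h2 : a₂ ∉ P) {x v : V} (hx : x ∉ P) (hv : v ∉ P) :
    prob p (delQ ends K a₁ a₂ ∩ connDelEvent ends K x v) =
      prob p (QPocketDel ends P K a₁ a₂) * outMass p ends P a₁ a₂ x v := by
  rw [delQ_inter_connDel_eq hP hKP h1 h2 hx hv]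
  have h := prob_pocket_mul_outside p ends (↑P : Set V)
    (fun σ => ¬ Conn ends (restrict (touches ends (↑K : Set V))ᶜ σ) a₁ a₂)
    (fun σ => ¬ Conn ends σ a₁ a₂ ∧ Conn ends σ x v)
  have e1 : QOutside ends (↑P : Set V) a₁ a₂ ∩
      {ω | Conn ends (restrict (touches ends (↑P : Set V))ᶜ ω) x v} =
      {ω | ¬ Conn ends (restrict (touches ends (↑P : Set V))ᶜ ω) a₁ a₂ ∧
        Conn ends (restrict (touches ends (↑P : Set V))ᶜ ω) x v} := by
    ext ω
    simp only [QOutside, Set.mem_inter_iff, Set.mem_setOf_eq]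
  rw [outMass, e1]
  exact h

/-- The residual `P_{G∖K}(Q)` factors as `P(residual pocket Q) · P(Q₁)`. -/
theorem prob_delQ (p : E → R) (hP : IsPocket ends (↑P : Set V) a₁ a₂) (hKP : K ⊆ P)
    (h1 : a₁ ∉ P) (h2 : a₂ ∉ P) :
    prob p (delQ ends K a₁ a₂) =
      prob p (QPocketDel ends P K a₁ a₂) * prob p (QOutside ends (↑P : Set V) a₁ a₂) := by
  rw [delQ_eq hP hKP h1 h2]
  exact prob_pocket_mul_outside p ends (↑P : Set V)
    (fun σ => ¬ Conn ends (restrict (touches ends (↑K : Set V))ᶜ σ) a₁ a₂)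
    (fun σ => ¬ Conn ends σ a₁ a₂)

end Prob

section Field

variable [Fintype E] [DecidableEq E] {R : Type*} [Field R]

/-- **The PD-type term on a pocket cluster.**  For `K ⊆ P` and the markers `o, b` outside the
pocket, `termPD(K) = P(Q_{P∖K}) · (A_L¹B_H¹ + A_H¹B_L¹) / Z₁`: the residual graph `G ∖ K` sees
the pocket only through the residual pocket probability. -/
theorem termPD_pocket (p : E → R) (hP : IsPocket ends (↑P : Set V) a₁ a₂) (hKP : K ⊆ P)
    (h1 : a₁ ∉ P) (h2 : a₂ ∉ P) {o b : V} (ho : o ∉ P) (hb : b ∉ P) :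
    termPD p ends K o a₁ a₂ b =
      prob p (QPocketDel ends P K a₁ a₂) *
        ((outMass p ends P a₁ a₂ a₁ o * outMass p ends P a₁ a₂ a₂ b +
            outMass p ends P a₁ a₂ a₂ o * outMass p ends P a₁ a₂ a₁ b) /
          prob p (QOutside ends (↑P : Set V) a₁ a₂)) := by
  have hoK : o ∉ K := fun h => ho (hKP h)
  have hbK : b ∉ K := fun h => hb (hKP h)
  simp only [termPD, delShareMass, hoK, hbK, if_false]
  rw [prob_delQ_inter_connDel p hP hKP h1 h2 h1 ho, prob_delQ_inter_connDel p hP hKP h1 h2 h2 hb,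
    prob_delQ_inter_connDel p hP hKP h1 h2 h2 ho, prob_delQ_inter_connDel p hP hKP h1 h2 h1 hb,
    prob_delQ p hP hKP h1 h2]
  set q := prob p (QPocketDel ends P K a₁ a₂)
  set Z := prob p (QOutside ends (↑P : Set V) a₁ a₂)
  rcases eq_or_ne q 0 with hq | hq
  · simp [hq]
  rcases eq_or_ne Z 0 with hZ | hZ
  · simp [hZ]
  field_simp

end Field

/-- The π₀ event: `Q_P` holds and `a₃` reaches no root inside the pocket. -/
def PDPocket (ends : E → Sym2 V) (P : Finset V) (a₁ a₂ a₃ : V) : Set (Config E) :=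
  {ω | ¬ Conn ends (restrict (touches ends (↑P : Set V)) ω) a₁ a₂ ∧
    ¬ Conn ends (restrict (touches ends (↑P : Set V)) ω) a₃ a₁ ∧
    ¬ Conn ends (restrict (touches ends (↑P : Set V)) ω) a₃ a₂}

variable {ends : E → Sym2 V} {P : Finset V} {a₁ a₂ a₃ : V}

/-- On the π₀ event a pocket vertex `a₃` reaches no root at all. -/
lemma not_conn_root_of_PDPocket (hP : IsPocket ends (↑P : Set V) a₁ a₂) (h3 : a₃ ∈ P)
    {ω : Config E} (hω : ω ∈ PDPocket ends P a₁ a₂ a₃) {r : V} (hrP : r ∉ P) :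
    ¬ Conn ends ω a₃ r := by
  intro hc
  obtain ⟨_, h31, h32⟩ := hω
  have key : r ∈ {z | z ∈ (↑P : Set V) ∧
      Conn ends (restrict (touches ends (↑P : Set V)) ω) a₃ z} := by
    refine mem_of_conn_of_closed (ends := ends) (ω := ω) ?_
      ⟨by simpa using h3, conn_refl _ _ _⟩ hc
    rintro x ⟨hxP, hxc⟩ y hxy
    obtain ⟨_, e, he, hends⟩ := openGraph_adj.1 hxy
    have hxy' : Conn ends (restrict (touches ends (↑P : Set V)) ω) a₃ y :=
      conn_trans hxc (conn_of_openAdj (openAdj_restrict_touches he hends (Or.inl hxP)))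
    rcases hP e x y hends hxP with hyP | rfl | rfl
    · exact ⟨hyP, hxy'⟩
    · exact absurd hxy' h31
    · exact absurd hxy' h32
  exact hrP (by simpa using key.1)

/-- On `{C(a₃) = W}` with `W ⊆ P` free of roots, the residual pocket part of `Q_W` is exactly
the π₀ event. -/
lemma clusterEvent_inter_QPocketDel {W : Finset V} (hWP : W ⊆ P) (h1W : a₁ ∉ W)
    (h2W : a₂ ∉ W) :
    clusterEvent ends a₃ (↑W : Set V) ∩ QPocketDel ends P W a₁ a₂ =
      clusterEvent ends a₃ (↑W : Set V) ∩ PDPocket ends P a₁ a₂ a₃ := by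
  ext ω
  simp only [Set.mem_inter_iff, mem_clusterEvent, QPocketDel, PDPocket, Set.mem_setOf_eq]
  constructor
  · rintro ⟨hW, hQ⟩
    have hsub : cluster ends ω a₃ ⊆ (↑P : Set V) := hW ▸ Finset.coe_subset.2 hWP
    have hcl : cluster ends (restrict (touches ends (↑P : Set V)) ω) a₃ = (↑W : Set V) := by
      rw [cluster_restrict_touches_eq hsub, hW]
    refine ⟨hW, ?_, ?_, ?_⟩
    · rwa [conn_restrict_iff_of_cluster_eq hcl (by simpa using h1W)] at hQ
    · intro h
      apply h1W
      have h' : a₁ ∈ cluster ends (restrict (touches ends (↑P : Set V)) ω) a₃ := h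
      rw [hcl] at h'
      exact Finset.mem_coe.1 h'
    · intro h
      apply h2W
      have h' : a₂ ∈ cluster ends (restrict (touches ends (↑P : Set V)) ω) a₃ := h
      rw [hcl] at h'
      exact Finset.mem_coe.1 h'
  · rintro ⟨hW, hQP, _, _⟩
    have hsub : cluster ends ω a₃ ⊆ (↑P : Set V) := hW ▸ Finset.coe_subset.2 hWP
    have hcl : cluster ends (restrict (touches ends (↑P : Set V)) ω) a₃ = (↑W : Set V) := by
      rw [cluster_restrict_touches_eq hsub, hW]
    refine ⟨hW, ?_⟩
    rwa [conn_restrict_iff_of_cluster_eq hcl (by simpa using h1W)]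

omit [Fintype V] [DecidableEq V] in
/-- A root-free cluster of `a₃` lies inside the pocket: `{C(a₃) = W}` is empty unless `W ⊆ P`. -/
lemma clusterEvent_eq_empty_of_not_subset (hP : IsPocket ends (↑P : Set V) a₁ a₂) (h3 : a₃ ∈ P)
    {W : Finset V} (hWP : ¬ W ⊆ P) (h1W : a₁ ∉ W) (h2W : a₂ ∉ W) :
    clusterEvent ends a₃ (↑W : Set V) = ∅ := by
  ext ω
  simp only [mem_clusterEvent, Set.mem_empty_iff_false, iff_false]
  intro hW
  apply hWP
  intro x hx
  have h1 : ¬ Conn ends ω a₃ a₁ := fun h => by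
    have h' : a₁ ∈ cluster ends ω a₃ := h
    rw [hW] at h'
    exact h1W (Finset.mem_coe.1 h')
  have h2 : ¬ Conn ends ω a₃ a₂ := fun h => by
    have h' : a₂ ∈ cluster ends ω a₃ := h
    rw [hW] at h'
    exact h2W (Finset.mem_coe.1 h')
  have hsub := cluster_subset_of_not_conn_roots hP (v := a₃) (by simpa using h3) h1 h2
  rw [hW] at hsub
  exact Finset.mem_coe.1 (hsub (Finset.mem_coe.2 hx))

section FieldRows

variable [Fintype E] [DecidableEq E] {R : Type*} [Field R]

/-- The PD row of `X̂` on a root-free cluster `W`: `P(C(a₃) = W) · termPD(W) =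
P({C(a₃) = W} ∩ π₀) · (A_L¹B_H¹ + A_H¹B_L¹)/Z₁`. -/
theorem clusterEvent_mul_termPD (p : E → R) (hP : IsPocket ends (↑P : Set V) a₁ a₂)
    (h1 : a₁ ∉ P) (h2 : a₂ ∉ P) {o b : V} (ho : o ∉ P) (hb : b ∉ P) (h3 : a₃ ∈ P)
    {W : Finset V} (h1W : a₁ ∉ W) (h2W : a₂ ∉ W) :
    prob p (clusterEvent ends a₃ (↑W : Set V)) * termPD p ends W o a₁ a₂ b =
      prob p (clusterEvent ends a₃ (↑W : Set V) ∩ PDPocket ends P a₁ a₂ a₃) *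
        ((outMass p ends P a₁ a₂ a₁ o * outMass p ends P a₁ a₂ a₂ b +
            outMass p ends P a₁ a₂ a₂ o * outMass p ends P a₁ a₂ a₁ b) /
          prob p (QOutside ends (↑P : Set V) a₁ a₂)) := by
  by_cases hWP : W ⊆ P
  · have hA : DependsOn (· ∈ QPocketDel ends P W a₁ a₂)
        ((touches ends (↑W : Set V))ᶜ ∩ touches ends (↑P : Set V)) := by
      have e : QPocketDel ends P W a₁ a₂ = {ω | ¬ Conn ends
          (restrict ((touches ends (↑W : Set V))ᶜ ∩ touches ends (↑P : Set V)) ω) a₁ a₂} := by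
        ext ω
        simp only [QPocketDel, Set.mem_setOf_eq, restrict_restrict']
      rw [e]
      exact dependsOn_restrict ((touches ends (↑W : Set V))ᶜ ∩ touches ends (↑P : Set V))
        (fun σ => ¬ Conn ends σ a₁ a₂)
    have hF : Disjoint (touches ends (↑W : Set V))
        ((touches ends (↑W : Set V))ᶜ ∩ touches ends (↑P : Set V)) :=
      Set.disjoint_left.2 fun _ he ⟨hne, _⟩ => hne he
    rw [termPD_pocket p hP hWP h1 h2 ho hb, ← mul_assoc,
      ← prob_clusterEvent_inter_eq_mul p ends a₃ (↑W : Set V) hA hF,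
      clusterEvent_inter_QPocketDel hWP h1W h2W]
  · rw [clusterEvent_eq_empty_of_not_subset hP h3 hWP h1W h2W]
    simp

/-- **The PD rows of `X̂` in a root-only pocket**: summed over the root-free clusters `W`,
`Σ_W P(C(a₃) = W) · termPD(W) = π₀ · (A_L¹B_H¹ + A_H¹B_L¹)/Z₁` with `π₀ = P(PDPocket)`. -/
theorem sum_pd_rows (p : E → R) (hP : IsPocket ends (↑P : Set V) a₁ a₂) (h1 : a₁ ∉ P)
    (h2 : a₂ ∉ P) {o b : V} (ho : o ∉ P) (hb : b ∉ P) (h3 : a₃ ∈ P) :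
    ∑ W : Finset V, (if a₁ ∉ W ∧ a₂ ∉ W then
        prob p (clusterEvent ends a₃ (↑W : Set V)) * termPD p ends W o a₁ a₂ b else 0) =
      prob p (PDPocket ends P a₁ a₂ a₃) *
        ((outMass p ends P a₁ a₂ a₁ o * outMass p ends P a₁ a₂ a₂ b +
            outMass p ends P a₁ a₂ a₂ o * outMass p ends P a₁ a₂ a₁ b) /
          prob p (QOutside ends (↑P : Set V) a₁ a₂)) := by
  have hsum : ∀ W : Finset V, (if a₁ ∉ W ∧ a₂ ∉ W then
      prob p (clusterEvent ends a₃ (↑W : Set V)) * termPD p ends W o a₁ a₂ b else 0) =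
      prob p (clusterEvent ends a₃ (↑W : Set V) ∩ PDPocket ends P a₁ a₂ a₃) *
        ((outMass p ends P a₁ a₂ a₁ o * outMass p ends P a₁ a₂ a₂ b +
            outMass p ends P a₁ a₂ a₂ o * outMass p ends P a₁ a₂ a₁ b) /
          prob p (QOutside ends (↑P : Set V) a₁ a₂)) := by
    intro W
    split_ifs with hW
    · exact clusterEvent_mul_termPD p hP h1 h2 ho hb h3 hW.1 hW.2
    · have hempty : clusterEvent ends a₃ (↑W : Set V) ∩ PDPocket ends P a₁ a₂ a₃ = ∅ := by
        ext ω
        simp only [Set.mem_inter_iff, mem_clusterEvent, Set.mem_empty_iff_false, iff_false,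
          not_and]
        intro hWc hω
        rw [not_and_or, not_not, not_not] at hW
        rcases hW with h | h
        · refine not_conn_root_of_PDPocket hP h3 hω h1 ?_
          show a₁ ∈ cluster ends ω a₃
          rw [hWc]
          exact Finset.mem_coe.2 h
        · refine not_conn_root_of_PDPocket hP h3 hω h2 ?_
          show a₂ ∈ cluster ends ω a₃
          rw [hWc]
          exact Finset.mem_coe.2 h
      rw [hempty, prob_empty, zero_mul]
  rw [Finset.sum_congr rfl (fun W _ => hsum W), ← Finset.sum_mul, ← prob_eq_sum_clusterEvent]

end FieldRows

end Finite

end PocketConn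

end Summit.Ventures.PercRepro2
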